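import Summits.NavierStokesRegularity.NavierStokesRegularity.Theorems.StretchingWellBindingEnstrophyQuarterLawSingularPointConcentration
import Summits.NavierStokesRegularity.NavierStokesRegularity.Theorems.StretchingWellBindingEnstrophyQuarterLawRegisteredStatus
import Summits.NavierStokesRegularity.NavierStokesRegularity.Theses.StretchingWellBinding
import Summits.NavierStokesRegularity.NavierStokesRegularity.Theses.TypeILiouville
import Summits.NavierStokesRegularity.NavierStokesRegularity.Theses.HalfHolderEnergy
import Summits.NavierStokesRegularity.NavierStokesRegularity.Theses.TypeIQuarterGate
import Summits.NavierStokesRegularity.NavierStokesRegularity.Theses.EfficiencyFloor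
import HarnessLib

/-!
# Shelf crux `EnstrophyQuarterLaw` (stmt-NavierStokesRegularity-1574), line «sparse_sieve»:
# the two open velocity-side stubs force FINITELY MANY SINGULAR POINTS at the first blow-up time

Helper file (`--supports stmt-NavierStokesRegularity-1574`; it closes no registered stub). The skeleton of
record `Cruxes/EnstrophyQuarterLaw/Lines/sparse_sieve.lean` (sha `3cd087f4…`) has three open stubs:
`stub_uniformLocalTypeI` (S1, predicate `UniformLocalTypeI T u`), `stub_uniformSparseness` (S2, predicate
`UniformSparseness T u`, "no satellite swarms" — the line's private currency) and `stub_noTypeII` (S6 = stmt-0056).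
The tree already records S1 ⟸ S6, S1 ∧ S2 ⟸ the crux, and `EnstrophyQuarterLaw ⟺ S6 ∧ (∀ S2)`
(`…RegisteredStatus`). What the tree did NOT record is what S2 costs in classical terms. This file proves:

* `exists_card_le_of_uniformLocalTypeI_of_uniformSparseness` / `finite_singularSet_…` / `ncard_singularSet_le_…` —
  **S1 ∧ S2 ⟹ the set of singular points of the slice `t = T` is FINITE**, with the explicit bound `N₀(ε₀)` of S2
  at the threshold `ε₀ = min(1, γν³)` (`γ` universal): distinct singular points are `4r`-separated once
  `r = ρ√(ν(T-t))/2` is small, and each of their `2r`-balls carries `L³`-mass `≥ ε₀³` by Barker–Prange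
  concentration at EVERY singular point with ONE onset time (sibling file
  `…EnstrophyQuarterLawSingularPointConcentration.lean`, from the tree-proved `BarkerPrange2020_thm2_holds`), so
  S2 counts them.
* By-name corollaries in the registered vocabulary: `finite_singularSet_of_stubs` (registered signatures of S1 and
  S2 ⟹ every first blow-up has finitely many singular points), `finite_singularSet_of_stub_noTypeII_of_stub_uniformSparseness`
  (S6 ∧ S2 ⟹ same, S1 being absorbed by S6), and `finite_singularSet_of_enstrophyQuarterLaw` /
  `finite_singularSet_of_enstrophyQuarterLaw'` (the crux, in either route copy, ⟹ same) — the consequence the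
  item's informal text lists as «expected, to be checked (leray-quanta graft): finitely many singular points at T»,
  now checked.

* Per-solution forms (appended): `finite_singularSet_of_windowLaw` / `finite_singularSet_of_sliceQuarterLaw` — ONE
  maximal smooth Leray–Hopf solution whose enstrophy blows up at Leray's rate `Z ≤ K/√(T − t)` (or obeys the
  window law) has finitely many singular points at `T`; `finite_singularSet_of_isTypeIBlowup_of_uniformSparseness`
  (sup-norm Type I ∧ S2, one solution); `finite_singularSet_of_energyHalfHolder` (crux stmt-25161 ⟹ same).

* Contrapositive forms (appended): infinitely many singular points at `T` ⟹ `limsup Z√(T−t) = ∞`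
  (`exists_enstrophy_gt_of_infinite_singularSet`), the window law fails for every constant, and — at a sup-norm
  Type-I blow-up — uniform sparseness fails (`not_uniformSparseness_of_isTypeIBlowup_of_infinite_singularSet`);
  `finite_singularSet_of_quarterLawTypeI`: crux `QuarterLawTypeI` (stmt-23726) ⟹ Type-I blow-ups have finite singular sets.

READING (planner-facing). Any proof of the registered stub `stub_uniformSparseness` proves in particular that every
first blow-up (classical Leray–Hopf, rapidly decaying datum) which is locally Type I in the CKN quantity `A` has
finitely many singular points at the blow-up time; with `stub_noTypeII` (0056) the line asserts «Type I ⟹ finitely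
many singular points at the first singular time», known in print only under scale-critical Morrey / weak-`L³` control.
HONEST FRAMING: implications between OPEN statements about hypothetical blow-ups; no registered stub is closed;
`EnstrophyQuarterLaw` (1574) and `TypeIliouvilleNoTypeII` (0056) stay OPEN; nothing here proves NS regularity.
-/

noncomputable section

-- the summit and its single sub-problem share the name (CONVENTIONS §1), as in every Theorems file
set_option linter.dupNamespace false

namespace Summit.NavierStokesRegularity.NavierStokesRegularity.Theorems.EnstrophyQuarterLaw.SparseSieve.FiniteSingularSet

open MeasureTheory Set Function Filter Topology TopologicalSpace Metric
open Literature.Analysis.FluidPDE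
open scoped NNReal ENNReal

/-- **S1 ∧ S2 ⟹ a uniform bound on the number of singular points (quantitative form).** For a classical
solution of the unforced Navier–Stokes system on `ℝ³ × [0, T)`, Leray–Hopf from its rapidly decaying datum,
`UniformLocalTypeI T u` and `UniformSparseness T u` give a natural number `N` (the sparseness bound `N₀(ε₀)` at
the threshold `ε₀ = min(1, γν³)`, `γ` universal) such that every finite set of singular points of the slice
`t = T` (essential unboundedness on all backward cylinders) has at most `N` elements. Proof: Barker–Prange
concentration at every singular point with a common onset time (`bp_concentration_at_every_singularPoint`);
at a late time `t` the radius `r = ρ√(ν(T-t))/2` is below the sparseness scale `r₀` and a quarter of the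
minimal distance of the given points, so the family is `4r`-separated with `∫_{B_{2r}} |u(t)|³ ≥ γν³ ≥ ε₀³` at
each point, and S2 bounds its size. [folklore] -/
theorem exists_card_le_of_uniformLocalTypeI_of_uniformSparseness {ν T : ℝ} (hν : 0 < ν) (hT : 0 < T)
    {u : ℝ → EuclideanSpace ℝ (Fin 3) → EuclideanSpace ℝ (Fin 3)} {p : ℝ → EuclideanSpace ℝ (Fin 3) → ℝ}
    (hcl : IsClassicalNSSolutionOn (Ico 0 T) ν 0 u p) (hLH : IsLerayHopfOn T ν 0 (u 0) u)
    (hdec : HasRapidSpatialDecay (u 0)) (hA : UniformLocalTypeI T u) (hS : UniformSparseness T u) :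
    ∃ N : ℕ, ∀ F : Finset (EuclideanSpace ℝ (Fin 3)),
      (∀ x₀ ∈ F, ∀ r : ℝ, 0 < r → r ^ 2 < T →
        eLpNorm (uncurry u) ∞ (volume.restrict (parabolicCylinder r ((T : ℝ), x₀))) = ∞) →
      F.card ≤ N := by
  obtain ⟨γ, hγ, hBP⟩ := bp_concentration_at_every_singularPoint
  obtain ⟨M, hM, r₁, hr₁, hmor⟩ := morrey_of_uniformLocalTypeI hν hT hcl hA
  obtain ⟨ρ, hρ, hmain⟩ := hBP M hM
  obtain ⟨t₁, ht₁0, ht₁T, hconc⟩ := hmain ν T hν hT u p hcl hLH hdec ⟨r₁, hr₁, hmor⟩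
  obtain ⟨r₀, hr₀, hS⟩ := hS
  set ε₀ : ℝ := min 1 (γ * ν ^ 3) with hε₀def
  have hε₀ : 0 < ε₀ := lt_min one_pos (by positivity)
  have hε₀cube : ε₀ ^ 3 ≤ γ * ν ^ 3 :=
    calc ε₀ ^ 3 ≤ ε₀ ^ 1 := pow_le_pow_of_le_one hε₀.le (min_le_left _ _) (by norm_num)
      _ = ε₀ := pow_one _
      _ ≤ γ * ν ^ 3 := min_le_right _ _
  obtain ⟨N₀, hN₀⟩ := hS ε₀ hε₀
  refine ⟨N₀, fun F hF => ?_⟩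
  -- separation of the given points
  obtain ⟨δ, hδ, hsep⟩ := exists_pos_le_dist_of_finset F
  -- a late time `t = T - τ`
  set η : ℝ := min (2 * r₀ / ρ) (δ / (2 * ρ)) with hηdef
  have hη : 0 < η := lt_min (by positivity) (by positivity)
  set τ : ℝ := min ((T - t₁) / 2) (η ^ 2 / ν) with hτdef
  have hτ : 0 < τ := lt_min (by linarith) (by positivity)
  have hτ1 : τ ≤ (T - t₁) / 2 := min_le_left _ _
  have hτ2 : τ ≤ η ^ 2 / ν := min_le_right _ _
  set t : ℝ := T - τ with htdef
  have htT : t < T := by rw [htdef]; linarith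
  have ht₁t : t₁ < t := by rw [htdef]; linarith
  have ht0 : 0 ≤ t := ht₁0.trans ht₁t.le
  have hsqrt : Real.sqrt (ν * (T - t)) ≤ η := by
    have h1 : ν * (T - t) ≤ η ^ 2 := by
      rw [htdef, show T - (T - τ) = τ by ring]
      calc ν * τ ≤ ν * (η ^ 2 / ν) := by gcongr
        _ = η ^ 2 := by field_simp
    calc Real.sqrt (ν * (T - t)) ≤ Real.sqrt (η ^ 2) := Real.sqrt_le_sqrt h1
      _ = η := Real.sqrt_sq hη.le
  have hνTt : 0 < ν * (T - t) := mul_pos hν (sub_pos.2 htT)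
  -- the radius `r = ρ √(ν (T - t)) / 2`
  set r : ℝ := ρ * Real.sqrt (ν * (T - t)) / 2 with hrdef
  have hr : 0 < r := by
    have : 0 < Real.sqrt (ν * (T - t)) := Real.sqrt_pos.2 hνTt
    rw [hrdef]; positivity
  have hrr₀ : r ≤ r₀ :=
    calc r ≤ ρ * η / 2 := by rw [hrdef]; gcongr
      _ ≤ ρ * (2 * r₀ / ρ) / 2 := by gcongr; exact min_le_left _ _
      _ = r₀ := by field_simp
  have h4r : 4 * r ≤ δ :=
    calc 4 * r = 2 * (ρ * Real.sqrt (ν * (T - t))) := by rw [hrdef]; ring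
      _ ≤ 2 * (ρ * η) := by gcongr
      _ ≤ 2 * (ρ * (δ / (2 * ρ))) := by gcongr; exact min_le_right _ _
      _ = δ := by field_simp
  have h2r : 2 * r = ρ * Real.sqrt (ν * (T - t)) := by rw [hrdef]; ring
  have hcont : Continuous (u t) := (hcl.contDiff_velocity ⟨ht0, htT⟩).continuous
  refine hN₀ t ⟨ht0, htT⟩ r ⟨hr, hrr₀⟩ F (fun x hx y hy hxy => h4r.trans (hsep x hx y hy hxy))
    (fun x hx => ?_)
  rw [h2r, typeIConc_lintegral_ball_enorm_pow_eq hcont x _ 3]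
  exact ENNReal.ofReal_le_ofReal (hε₀cube.trans (hconc x (hF x hx) t ⟨ht₁t, htT⟩))

/-- **S1 ∧ S2 ⟹ FINITELY MANY SINGULAR POINTS at the first blow-up time.** For a classical solution of the
unforced Navier–Stokes system on `ℝ³ × [0, T)`, Leray–Hopf from its rapidly decaying datum, the two open
velocity-side stubs of `Lines/sparse_sieve.lean` — `UniformLocalTypeI T u` and `UniformSparseness T u` — force
the set of singular points of the slice `t = T` (points `x₀` with `u` essentially unbounded on every backward
cylinder `(T - r², T) × B_r(x₀)`, `0 < r`, `r² < T`) to be finite. (If `u` extends smoothly past `T` the set is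
empty; at a genuine first blow-up it is nonempty by `exists_singularPoint_of_classical_of_not_hasSmoothExtensionPast`.)
[folklore] -/
theorem finite_singularSet_of_uniformLocalTypeI_of_uniformSparseness {ν T : ℝ} (hν : 0 < ν) (hT : 0 < T)
    {u : ℝ → EuclideanSpace ℝ (Fin 3) → EuclideanSpace ℝ (Fin 3)} {p : ℝ → EuclideanSpace ℝ (Fin 3) → ℝ}
    (hcl : IsClassicalNSSolutionOn (Ico 0 T) ν 0 u p) (hLH : IsLerayHopfOn T ν 0 (u 0) u)
    (hdec : HasRapidSpatialDecay (u 0)) (hA : UniformLocalTypeI T u) (hS : UniformSparseness T u) :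
    Set.Finite {x₀ : EuclideanSpace ℝ (Fin 3) | ∀ r : ℝ, 0 < r → r ^ 2 < T →
      eLpNorm (uncurry u) ∞ (volume.restrict (parabolicCylinder r ((T : ℝ), x₀))) = ∞} := by
  obtain ⟨N, hN⟩ := exists_card_le_of_uniformLocalTypeI_of_uniformSparseness hν hT hcl hLH hdec hA hS
  by_contra hinf
  obtain ⟨F, hFsub, hFcard⟩ := Set.Infinite.exists_subset_card_eq hinf (N + 1)
  have h := hN F (fun x₀ hx₀ => hFsub (Finset.mem_coe.2 hx₀))
  omega

/-- **Quantitative form with the cardinality of the singular set**: under S1 ∧ S2 the singular set of the slice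
`t = T` is finite AND its cardinality is bounded by the number `N` of
`exists_card_le_of_uniformLocalTypeI_of_uniformSparseness` (the sparseness bound at the universal threshold).
[folklore] -/
theorem ncard_singularSet_le_of_uniformLocalTypeI_of_uniformSparseness {ν T : ℝ} (hν : 0 < ν) (hT : 0 < T)
    {u : ℝ → EuclideanSpace ℝ (Fin 3) → EuclideanSpace ℝ (Fin 3)} {p : ℝ → EuclideanSpace ℝ (Fin 3) → ℝ}
    (hcl : IsClassicalNSSolutionOn (Ico 0 T) ν 0 u p) (hLH : IsLerayHopfOn T ν 0 (u 0) u)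
    (hdec : HasRapidSpatialDecay (u 0)) (hA : UniformLocalTypeI T u) (hS : UniformSparseness T u) :
    ∃ N : ℕ, (∀ F : Finset (EuclideanSpace ℝ (Fin 3)),
      (∀ x₀ ∈ F, ∀ r : ℝ, 0 < r → r ^ 2 < T →
        eLpNorm (uncurry u) ∞ (volume.restrict (parabolicCylinder r ((T : ℝ), x₀))) = ∞) →
      F.card ≤ N) ∧
      Set.ncard {x₀ : EuclideanSpace ℝ (Fin 3) | ∀ r : ℝ, 0 < r → r ^ 2 < T →
        eLpNorm (uncurry u) ∞ (volume.restrict (parabolicCylinder r ((T : ℝ), x₀))) = ∞} ≤ N := by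
  obtain ⟨N, hN⟩ := exists_card_le_of_uniformLocalTypeI_of_uniformSparseness hν hT hcl hLH hdec hA hS
  have hfin := finite_singularSet_of_uniformLocalTypeI_of_uniformSparseness hν hT hcl hLH hdec hA hS
  refine ⟨N, hN, ?_⟩
  rw [Set.ncard_eq_toFinset_card _ hfin]
  exact hN _ (fun x₀ hx₀ => (Set.Finite.mem_toFinset hfin).1 hx₀)

/-! ### By-name corollaries in the registered vocabulary of `Lines/sparse_sieve.lean` -/

/-- **Registered stubs S1 ∧ S2 ⟹ every first blow-up has finitely many singular points.** The registered
signatures of `stub_uniformLocalTypeI` and `stub_uniformSparseness` (hypotheses, verbatim over the importable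
predicates of `…SparseSieveDefs`) imply: at every maximal smooth solution, Leray–Hopf from a rapidly decaying
datum, the singular set of the blow-up slice is finite. Implication between OPEN statements; neither stub is
asserted. [folklore] -/
theorem finite_singularSet_of_stubs
    (hS1 : ∀ (ν T : ℝ), 0 < ν → 0 < T →
      ∀ (u : ℝ → EuclideanSpace ℝ (Fin 3) → EuclideanSpace ℝ (Fin 3))
        (p : ℝ → EuclideanSpace ℝ (Fin 3) → ℝ),
      IsMaximalSmoothSolution ν 0 u p T → IsLerayHopfOn T ν 0 (u 0) u →
      HasRapidSpatialDecay (u 0) → UniformLocalTypeI T u)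
    (hS2 : ∀ (ν T : ℝ), 0 < ν → 0 < T →
      ∀ (u : ℝ → EuclideanSpace ℝ (Fin 3) → EuclideanSpace ℝ (Fin 3))
        (p : ℝ → EuclideanSpace ℝ (Fin 3) → ℝ),
      IsMaximalSmoothSolution ν 0 u p T → IsLerayHopfOn T ν 0 (u 0) u →
      HasRapidSpatialDecay (u 0) → UniformSparseness T u) :
    ∀ (ν T : ℝ), 0 < ν → 0 < T →
      ∀ (u : ℝ → EuclideanSpace ℝ (Fin 3) → EuclideanSpace ℝ (Fin 3))
        (p : ℝ → EuclideanSpace ℝ (Fin 3) → ℝ),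
      IsMaximalSmoothSolution ν 0 u p T → IsLerayHopfOn T ν 0 (u 0) u →
      HasRapidSpatialDecay (u 0) →
      Set.Finite {x₀ : EuclideanSpace ℝ (Fin 3) | ∀ r : ℝ, 0 < r → r ^ 2 < T →
        eLpNorm (uncurry u) ∞ (volume.restrict (parabolicCylinder r ((T : ℝ), x₀))) = ∞} :=
  fun ν T hν hT u p hmax hLH hdec =>
    finite_singularSet_of_uniformLocalTypeI_of_uniformSparseness hν hT hmax.1 hLH hdec
      (hS1 ν T hν hT u p hmax hLH hdec) (hS2 ν T hν hT u p hmax hLH hdec)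

/-- **Registered stubs S6 (= stmt-0056) ∧ S2 ⟹ every first blow-up has finitely many singular points**
(S1 is absorbed by S6 through `Registered.stub_uniformLocalTypeI_of_stub_noTypeII`): what the line's private
currency `UniformSparseness` asserts ON TOP of sup-norm Type I includes «Type I ⟹ finitely many singular points at
the first singular time». Implication between OPEN statements. [folklore] -/
theorem finite_singularSet_of_stub_noTypeII_of_stub_uniformSparseness
    (hS6 : Summit.NavierStokesRegularity.NavierStokesRegularity.Theses.TypeILiouville.TypeIliouvilleNoTypeII)
    (hS2 : ∀ (ν T : ℝ), 0 < ν → 0 < T →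
      ∀ (u : ℝ → EuclideanSpace ℝ (Fin 3) → EuclideanSpace ℝ (Fin 3))
        (p : ℝ → EuclideanSpace ℝ (Fin 3) → ℝ),
      IsMaximalSmoothSolution ν 0 u p T → IsLerayHopfOn T ν 0 (u 0) u →
      HasRapidSpatialDecay (u 0) → UniformSparseness T u) :
    ∀ (ν T : ℝ), 0 < ν → 0 < T →
      ∀ (u : ℝ → EuclideanSpace ℝ (Fin 3) → EuclideanSpace ℝ (Fin 3))
        (p : ℝ → EuclideanSpace ℝ (Fin 3) → ℝ),
      IsMaximalSmoothSolution ν 0 u p T → IsLerayHopfOn T ν 0 (u 0) u →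
      HasRapidSpatialDecay (u 0) →
      Set.Finite {x₀ : EuclideanSpace ℝ (Fin 3) | ∀ r : ℝ, 0 < r → r ^ 2 < T →
        eLpNorm (uncurry u) ∞ (volume.restrict (parabolicCylinder r ((T : ℝ), x₀))) = ∞} :=
  finite_singularSet_of_stubs (Registered.stub_uniformLocalTypeI_of_stub_noTypeII hS6) hS2

/-- **The crux ⟹ finitely many singular points at every first blow-up** (`EnstrophyQuarterLaw`, shelf copy of
route StretchingWellBinding): the consequence listed in the item's informal text as «expected, to be checked:
finitely many singular points at T», obtained through the no-loss certificates `EnstrophyQuarterLaw ⟹ S1, S2`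
(`Registered.stub_uniformLocalTypeI_of_enstrophyQuarterLaw`, `Registered.stub_uniformSparseness_of_enstrophyQuarterLaw`)
and the count above. Implication from an OPEN statement; the crux is not asserted. [folklore] -/
theorem finite_singularSet_of_enstrophyQuarterLaw
    (hQ : Summit.NavierStokesRegularity.NavierStokesRegularity.Theses.StretchingWellBinding.EnstrophyQuarterLaw) :
    ∀ (ν T : ℝ), 0 < ν → 0 < T →
      ∀ (u : ℝ → EuclideanSpace ℝ (Fin 3) → EuclideanSpace ℝ (Fin 3))
        (p : ℝ → EuclideanSpace ℝ (Fin 3) → ℝ),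
      IsMaximalSmoothSolution ν 0 u p T → IsLerayHopfOn T ν 0 (u 0) u →
      HasRapidSpatialDecay (u 0) →
      Set.Finite {x₀ : EuclideanSpace ℝ (Fin 3) | ∀ r : ℝ, 0 < r → r ^ 2 < T →
        eLpNorm (uncurry u) ∞ (volume.restrict (parabolicCylinder r ((T : ℝ), x₀))) = ∞} :=
  finite_singularSet_of_stubs (Registered.stub_uniformLocalTypeI_of_enstrophyQuarterLaw hQ)
    (Registered.stub_uniformSparseness_of_enstrophyQuarterLaw hQ)

/-- **The crux ⟹ finitely many singular points at every first blow-up**, for the copy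
`Theses.EfficiencyFloor.EnstrophyQuarterLaw` of the shared item stmt-NavierStokesRegularity-1574 carried by route
EfficiencyFloor (same statement text; definitional unfolding). Implication from an OPEN statement. [folklore] -/
theorem finite_singularSet_of_enstrophyQuarterLaw'
    (hQ : Summit.NavierStokesRegularity.NavierStokesRegularity.Theses.EfficiencyFloor.EnstrophyQuarterLaw) :
    ∀ (ν T : ℝ), 0 < ν → 0 < T →
      ∀ (u : ℝ → EuclideanSpace ℝ (Fin 3) → EuclideanSpace ℝ (Fin 3))
        (p : ℝ → EuclideanSpace ℝ (Fin 3) → ℝ),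
      IsMaximalSmoothSolution ν 0 u p T → IsLerayHopfOn T ν 0 (u 0) u →
      HasRapidSpatialDecay (u 0) →
      Set.Finite {x₀ : EuclideanSpace ℝ (Fin 3) | ∀ r : ℝ, 0 < r → r ^ 2 < T →
        eLpNorm (uncurry u) ∞ (volume.restrict (parabolicCylinder r ((T : ℝ), x₀))) = ∞} :=
  finite_singularSet_of_enstrophyQuarterLaw (fun ν T hν hT u p hmax hLH hdec => hQ ν T hν hT u p hmax hLH hdec)

/-! ### Per-solution forms (appended 2026-08-31): ONE first blow-up at Leray's enstrophy rate -/

/-- **WINDOW QUARTER LAW ⟹ FINITELY MANY SINGULAR POINTS, for one solution.** Let `(u, p)` be a maximal smooth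
solution on `[0, T)` (classical, no smooth extension past `T`), Leray–Hopf from its rapidly decaying datum, whose
enstrophy obeys the energy `½`-Hölder window law `∫_a^b ∫ |curl u|² ≤ K √(b − a)` (`0 ≤ a ≤ b ≤ T`). Then the
set of singular points of the blow-up slice `t = T` is finite. Assembly of tree theorems, all per-solution:
S1 from the window law (`LocalTypeI.uniformLocalTypeI_of_window`), the far-field enstrophy bound
(`SparseSieve.Registered.stub_farFieldEnstrophy`, Tao's localisation), S2 from the window law and the far field
(`SparsenessCoarse.uniformSparseness_of_window`), then `finite_singularSet_of_uniformLocalTypeI_of_uniformSparseness`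
(Barker–Prange concentration at every singular point). A statement about ONE hypothetical blow-up; nothing is
asserted about all blow-ups. [folklore] -/
theorem finite_singularSet_of_windowLaw {ν T : ℝ} (hν : 0 < ν) (hT : 0 < T)
    {u : ℝ → EuclideanSpace ℝ (Fin 3) → EuclideanSpace ℝ (Fin 3)} {p : ℝ → EuclideanSpace ℝ (Fin 3) → ℝ}
    (hmax : IsMaximalSmoothSolution ν 0 u p T) (hLH : IsLerayHopfOn T ν 0 (u 0) u)
    (hdec : HasRapidSpatialDecay (u 0)) {K : ℝ}
    (hwin : ∀ a b : ℝ, 0 ≤ a → a ≤ b → b ≤ T →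
      ∫⁻ t in Ioo a b, ∫⁻ x, ‖curl (u t) x‖ₑ ^ 2 ≤ ENNReal.ofReal (K * Real.sqrt (b - a))) :
    Set.Finite {x₀ : EuclideanSpace ℝ (Fin 3) | ∀ r : ℝ, 0 < r → r ^ 2 < T →
      eLpNorm (uncurry u) ∞ (volume.restrict (parabolicCylinder r ((T : ℝ), x₀))) = ∞} := by
  -- the window law with a non-negative constant
  have hwin' : ∀ a b : ℝ, 0 ≤ a → a ≤ b → b ≤ T →
      ∫⁻ t in Ioo a b, ∫⁻ x, ‖curl (u t) x‖ₑ ^ 2 ≤ ENNReal.ofReal (max K 0 * Real.sqrt (b - a)) :=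
    fun a b ha hab hb => (hwin a b ha hab hb).trans (ENNReal.ofReal_le_ofReal
      (mul_le_mul_of_nonneg_right (le_max_left _ _) (Real.sqrt_nonneg _)))
  have hS1 : UniformLocalTypeI T u :=
    LocalTypeI.uniformLocalTypeI_of_window hν hT hmax.1 hLH hdec hwin
  obtain ⟨ρ, B, hB, hFF⟩ := SparseSieve.Registered.stub_farFieldEnstrophy ν T hν hT u p hmax hLH hdec
  have hS2 : UniformSparseness T u :=
    SparsenessCoarse.uniformSparseness_of_window hν hT hmax.1 hLH hdec (le_max_right K 0) hwin' hB hFF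
  exact finite_singularSet_of_uniformLocalTypeI_of_uniformSparseness hν hT hmax.1 hLH hdec hS1 hS2

/-- **LERAY-RATE ENSTROPHY BLOW-UP ⟹ FINITELY MANY SINGULAR POINTS, for one solution.** A maximal smooth
solution on `[0, T)`, Leray–Hopf from its rapidly decaying datum, whose enstrophy obeys the slice quarter law
`∫ |curl u(t)|² ≤ K/√(T − t)` on `[0, T)` (blow-up at exactly Leray's rate, "enstrophy-Type-I") has finitely many
singular points at the blow-up time: the slice law integrates to the window law with constant `2 max(K, 0)`
(`WindowConverters.lintegral_Ioo_le_sqrt_of_slice_le`), then `finite_singularSet_of_windowLaw`. This is the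
per-solution content of the item's informal remark «expected, to be checked (leray-quanta graft): finitely many
singular points at T». [folklore] -/
theorem finite_singularSet_of_sliceQuarterLaw {ν T : ℝ} (hν : 0 < ν) (hT : 0 < T)
    {u : ℝ → EuclideanSpace ℝ (Fin 3) → EuclideanSpace ℝ (Fin 3)} {p : ℝ → EuclideanSpace ℝ (Fin 3) → ℝ}
    (hmax : IsMaximalSmoothSolution ν 0 u p T) (hLH : IsLerayHopfOn T ν 0 (u 0) u)
    (hdec : HasRapidSpatialDecay (u 0)) {K : ℝ}
    (hZ : ∀ t ∈ Ico 0 T, ∫⁻ x, ‖curl (u t) x‖ₑ ^ 2 ≤ ENNReal.ofReal (K / Real.sqrt (T - t))) :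
    Set.Finite {x₀ : EuclideanSpace ℝ (Fin 3) | ∀ r : ℝ, 0 < r → r ^ 2 < T →
      eLpNorm (uncurry u) ∞ (volume.restrict (parabolicCylinder r ((T : ℝ), x₀))) = ∞} := by
  have hZ' : ∀ t ∈ Ico 0 T,
      ∫⁻ x, ‖curl (u t) x‖ₑ ^ 2 ≤ ENNReal.ofReal (max K 0 / Real.sqrt (T - t)) :=
    fun t ht => (hZ t ht).trans
      (ENNReal.ofReal_le_ofReal (div_le_div_of_nonneg_right (le_max_left _ _) (Real.sqrt_nonneg _)))
  exact finite_singularSet_of_windowLaw hν hT hmax hLH hdec (K := 2 * max K 0)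
    (fun a b ha hab hb => WindowConverters.lintegral_Ioo_le_sqrt_of_slice_le (le_max_right K 0) hZ' ha hab hb)

/-- **Sup-norm Type-I first blow-up: uniform sparseness ⟹ finitely many singular points, for one solution.**
At a Type-I blow-up (`IsTypeIBlowup u T`: `|u(t, x)| ≤ C/√(T − t)` near `T`) of a classical Leray–Hopf solution
from a rapidly decaying datum, S1 holds by `CountQuarterLaw.uniformLocalTypeI_of_isTypeIBlowup`, so S2 alone
(`UniformSparseness T u`) forces a finite singular set at time `T`. Per-solution statement; S2 is a hypothesis.
[folklore] -/
theorem finite_singularSet_of_isTypeIBlowup_of_uniformSparseness {ν T : ℝ} (hν : 0 < ν) (hT : 0 < T)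
    {u : ℝ → EuclideanSpace ℝ (Fin 3) → EuclideanSpace ℝ (Fin 3)} {p : ℝ → EuclideanSpace ℝ (Fin 3) → ℝ}
    (hcl : IsClassicalNSSolutionOn (Ico 0 T) ν 0 u p) (hLH : IsLerayHopfOn T ν 0 (u 0) u)
    (hdec : HasRapidSpatialDecay (u 0)) (hI : IsTypeIBlowup u T) (hS : UniformSparseness T u) :
    Set.Finite {x₀ : EuclideanSpace ℝ (Fin 3) | ∀ r : ℝ, 0 < r → r ^ 2 < T →
      eLpNorm (uncurry u) ∞ (volume.restrict (parabolicCylinder r ((T : ℝ), x₀))) = ∞} :=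
  finite_singularSet_of_uniformLocalTypeI_of_uniformSparseness hν hT hcl hLH hdec
    (CountQuarterLaw.uniformLocalTypeI_of_isTypeIBlowup hν hT hcl hLH hdec hI) hS

/-- **`EnergyHalfHolder` (stmt-NavierStokesRegularity-25161, crux of route HalfHolderEnergy) ⟹ finitely many
singular points at every first blow-up**, through the tree's characterisation
`EnergyHalfHolder ⟺ (∀ S1) ∧ (∀ S2)` (`SparseSieveCharacterisation.energyHalfHolder_iff_uniformLocalTypeI_and_uniformSparseness`)
and `finite_singularSet_of_stubs`. Implication from an OPEN statement; the crux is not asserted. [folklore] -/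
theorem finite_singularSet_of_energyHalfHolder
    (hH : Summit.NavierStokesRegularity.NavierStokesRegularity.Theses.HalfHolderEnergy.EnergyHalfHolder) :
    ∀ (ν T : ℝ), 0 < ν → 0 < T →
      ∀ (u : ℝ → EuclideanSpace ℝ (Fin 3) → EuclideanSpace ℝ (Fin 3))
        (p : ℝ → EuclideanSpace ℝ (Fin 3) → ℝ),
      IsMaximalSmoothSolution ν 0 u p T → IsLerayHopfOn T ν 0 (u 0) u →
      HasRapidSpatialDecay (u 0) →
      Set.Finite {x₀ : EuclideanSpace ℝ (Fin 3) | ∀ r : ℝ, 0 < r → r ^ 2 < T →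
        eLpNorm (uncurry u) ∞ (volume.restrict (parabolicCylinder r ((T : ℝ), x₀))) = ∞} :=
  have h := SparseSieveCharacterisation.energyHalfHolder_iff_uniformLocalTypeI_and_uniformSparseness.1 hH
  finite_singularSet_of_stubs h.1 h.2

/-! ### Contrapositive forms (appended 2026-08-31): infinitely many singular points -/

/-- **Infinitely many singular points ⟹ the enstrophy is not Leray-rate** (one maximal smooth Leray–Hopf
rapid-decay solution): for every `K` some slice `t ∈ [0, T)` has `Z(t) > K/√(T − t)`, i.e.
`limsup_{t↑T} Z(t)√(T − t) = ∞`. Contrapositive of `finite_singularSet_of_sliceQuarterLaw`. [folklore] -/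
theorem exists_enstrophy_gt_of_infinite_singularSet {ν T : ℝ} (hν : 0 < ν) (hT : 0 < T)
    {u : ℝ → EuclideanSpace ℝ (Fin 3) → EuclideanSpace ℝ (Fin 3)} {p : ℝ → EuclideanSpace ℝ (Fin 3) → ℝ}
    (hmax : IsMaximalSmoothSolution ν 0 u p T) (hLH : IsLerayHopfOn T ν 0 (u 0) u)
    (hdec : HasRapidSpatialDecay (u 0))
    (hinf : Set.Infinite {x₀ : EuclideanSpace ℝ (Fin 3) | ∀ r : ℝ, 0 < r → r ^ 2 < T →
      eLpNorm (uncurry u) ∞ (volume.restrict (parabolicCylinder r ((T : ℝ), x₀))) = ∞}) (K : ℝ) :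
    ∃ t ∈ Ico 0 T, ENNReal.ofReal (K / Real.sqrt (T - t)) < ∫⁻ x, ‖curl (u t) x‖ₑ ^ 2 := by
  by_contra h
  refine hinf (finite_singularSet_of_sliceQuarterLaw hν hT hmax hLH hdec (K := K) fun t ht => ?_)
  exact not_lt.1 fun hlt => h ⟨t, ht, hlt⟩

/-- **Infinitely many singular points ⟹ the energy `½`-Hölder window law fails for every constant** (one
solution): for every `K` some window `[a, b] ⊆ [0, T]` has `∫_a^b Z > K√(b − a)`. Contrapositive of
`finite_singularSet_of_windowLaw`. [folklore] -/
theorem exists_window_gt_of_infinite_singularSet {ν T : ℝ} (hν : 0 < ν) (hT : 0 < T)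
    {u : ℝ → EuclideanSpace ℝ (Fin 3) → EuclideanSpace ℝ (Fin 3)} {p : ℝ → EuclideanSpace ℝ (Fin 3) → ℝ}
    (hmax : IsMaximalSmoothSolution ν 0 u p T) (hLH : IsLerayHopfOn T ν 0 (u 0) u)
    (hdec : HasRapidSpatialDecay (u 0))
    (hinf : Set.Infinite {x₀ : EuclideanSpace ℝ (Fin 3) | ∀ r : ℝ, 0 < r → r ^ 2 < T →
      eLpNorm (uncurry u) ∞ (volume.restrict (parabolicCylinder r ((T : ℝ), x₀))) = ∞}) (K : ℝ) :
    ∃ a b : ℝ, 0 ≤ a ∧ a ≤ b ∧ b ≤ T ∧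
      ENNReal.ofReal (K * Real.sqrt (b - a)) < ∫⁻ t in Ioo a b, ∫⁻ x, ‖curl (u t) x‖ₑ ^ 2 := by
  by_contra h
  refine hinf (finite_singularSet_of_windowLaw hν hT hmax hLH hdec (K := K) fun a b ha hab hb => ?_)
  exact not_lt.1 fun hlt => h ⟨a, b, ha, hab, hb, hlt⟩

/-- **Sup-norm Type-I first blow-up with infinitely many singular points ⟹ satellite swarms** (one solution):
`UniformSparseness T u` fails, i.e. for some threshold `ε₀` there are, at times `t < T` and scales `r ≤ r₀`
(any `r₀`), `4r`-separated families of `ε₀`-concentrating `2r`-balls of unbounded size. Contrapositive of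
`finite_singularSet_of_isTypeIBlowup_of_uniformSparseness`. [folklore] -/
theorem not_uniformSparseness_of_isTypeIBlowup_of_infinite_singularSet {ν T : ℝ} (hν : 0 < ν) (hT : 0 < T)
    {u : ℝ → EuclideanSpace ℝ (Fin 3) → EuclideanSpace ℝ (Fin 3)} {p : ℝ → EuclideanSpace ℝ (Fin 3) → ℝ}
    (hcl : IsClassicalNSSolutionOn (Ico 0 T) ν 0 u p) (hLH : IsLerayHopfOn T ν 0 (u 0) u)
    (hdec : HasRapidSpatialDecay (u 0)) (hI : IsTypeIBlowup u T)
    (hinf : Set.Infinite {x₀ : EuclideanSpace ℝ (Fin 3) | ∀ r : ℝ, 0 < r → r ^ 2 < T →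
      eLpNorm (uncurry u) ∞ (volume.restrict (parabolicCylinder r ((T : ℝ), x₀))) = ∞}) :
    ¬ UniformSparseness T u :=
  fun hS => hinf (finite_singularSet_of_isTypeIBlowup_of_uniformSparseness hν hT hcl hLH hdec hI hS)

/-- **`QuarterLawTypeI` (stmt-NavierStokesRegularity-23726, crux of route TypeIQuarterGate) ⟹ every sup-norm
Type-I first blow-up has finitely many singular points** (appended 2026-08-31): the quarter law on the Type-I
stratum feeds `finite_singularSet_of_sliceQuarterLaw` per solution. Implication from an OPEN statement; the crux
is not asserted. [folklore] -/
theorem finite_singularSet_of_quarterLawTypeI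
    (hK1 : Summit.NavierStokesRegularity.NavierStokesRegularity.Theses.TypeIQuarterGate.QuarterLawTypeI)
    {ν T : ℝ} (hν : 0 < ν) (hT : 0 < T)
    {u : ℝ → EuclideanSpace ℝ (Fin 3) → EuclideanSpace ℝ (Fin 3)} {p : ℝ → EuclideanSpace ℝ (Fin 3) → ℝ}
    (hmax : IsMaximalSmoothSolution ν 0 u p T) (hLH : IsLerayHopfOn T ν 0 (u 0) u)
    (hdec : HasRapidSpatialDecay (u 0)) (hI : IsTypeIBlowup u T) :
    Set.Finite {x₀ : EuclideanSpace ℝ (Fin 3) | ∀ r : ℝ, 0 < r → r ^ 2 < T →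
      eLpNorm (uncurry u) ∞ (volume.restrict (parabolicCylinder r ((T : ℝ), x₀))) = ∞} := by
  obtain ⟨K, hK⟩ := hK1 ν T hν hT u p hmax hLH hdec hI
  exact finite_singularSet_of_sliceQuarterLaw hν hT hmax hLH hdec hK

end Summit.NavierStokesRegularity.NavierStokesRegularity.Theorems.EnstrophyQuarterLaw.SparseSieve.FiniteSingularSet

end
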